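import Literature.MathematicalPhysics.QuantumFieldTheory.Balaban1983to89.Node00.CanonicalTransportOfRecord
import Literature.MathematicalPhysics.QuantumFieldTheory.Balaban1983to89.Node00.SmallFieldChi29OfRecord

/-!
# NODE 00 (YM-PLAN Track A) — INTEGRABILITY and the UNCONDITIONAL `IsRT` of the β-INPUTS of the (0.19) recursion, χ- AND TRANSPORT-GENERIC
# (every transport whose images of integrable densities are integrable — the versions `TcOnOfRecord ν`, `TcanOfRecord` —, every MEASURABLE χ with values in [0,1]),
# and the instances Record13 reads: `TcanOfRecord` with the (2.9) species `chiFixed29`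

Cell `pub-ymgap`, NODE 00, seat `pub-ymgap-node00-def-K0e` g3 (prover; K0′ row P7 ∕ the β-inputs of the successor record), FILE 7.  APPEND-ONLY growth: a NEW module over
this seat's FILE 6 (`Node00.CanonicalTransportOfRecord`: `TcanOfRecord`, `integrable_TcanOfRecord`, `isRT_TcanOfRecord`) and FILE 5 (`Node00.SmallFieldChi29OfRecord`:
`betaInputOfRecord`, `chiFixed29`, `measurable_chiFix29OfRecord_of`); nothing landed is edited.  THEOREMS ONLY; count-neutral; NOTHING of Bałaban's asserted.

WHY.  node00-def-T g7's `Record13` (director-ym №128: NO transport-regularity field, β reads the canonical version `TcanOfRecord`; №126 C4: the β-slot χ is the (2.9)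
species `chiFixed29 ν ε₁`) wants in its §8 the UNCONDITIONAL β-input faces «`=ᵐ transportOfRecord`, `IsRT`, continuous + determined on `regSet`».  The first and
third are χ-generic faces of FILE 6 (`TcanOfRecord_ae_eq`, `continuousOn_TcanOfRecord`, `TcanOfRecord_eqOn_of_continuousOn`).  The `IsRT` face needs the β-input
DENSITY to be integrable, and the two integrability lemmas in the tree are hard-wired: n09-a's `B12NodeKnitContinuousTransport.integrable_integrand_of_continuousTransport`
(χ-generic but for transports with CONTINUOUS images — `TcOfRecord` only) and this seat's FILE 2 `integrable_integrand_TcOnOfRecord` (domination, but at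
`TcOnOfRecord ν` with `chiFixed7 ν`).  THIS FILE proves the domination induction ONCE for every pair (T, χ) of the stated kind and instantiates it.

WHAT IS PROVED (0 `sorry`; [I] (0.17)–(0.19) p. 255 bookkeeping):
* §1 **`integrable_betaInputOfRecord_of_version`** — for a transport `T` with `∀ k < K, Integrable ρ → Integrable (T K k ρ)` and a χ family MEASURABLE with values in
  `[0,1]`: every β-input `betaInputOfRecord T χ K g k = χ_k·exp[−GF_k/g_k² + A_k]`, `k ≤ K`, is integrable (`|ρ_0| ≤ 1` at level 0 — the action `A_0 = −A/g_0² ≤ 0` reads no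
  transport, n09-a's `measurable_integrand`∕`abs_integrand_le`∕`integrable_of_bounded_measurable`; `|ρ_{k+1}| ≤ exp A_{k+1} ≤ |𝐍_k⁻¹·(T_kρ_k)| + 1` at level `k+1`, FILE 2's argument).
* §2 at the CANONICAL-VERSION transport: `integrable_betaInput_TcanOfRecord` (χ-generic), **`isRT_TcanOfRecord_betaInput`** (`k < K`: the image of every β-input IS a
  renormalisation transformation of it — no continuity proviso), `betaInput_TcanOfRecord_ae_eq` (the image is a version of the kernel transform); the same three at
  FILE 2's on-domain transport `TcOnOfRecord ν`, χ-generic (`integrable_betaInput_TcOnOfRecord`, `isRT_TcOnOfRecord_betaInput`).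
* §3 AT THE C4 SPECIES `χ := chiFixed29 ν ε₁` (Record13's β-slot χ): `integrable_betaInput_TcanOfRecord_chi29` and **`isRT_TcanOfRecord_betaInput_chi29`** under the ONE
  displayed hypothesis `hU : ∀ k, Measurable (Uk F N K (k+1) ν.εreg)` — LOCATED COST OF C4: the (2.9) cutoff reads node00-def-B's GLOBAL background `U_{k+1}(W)` of
  (0.21)∕(2.3), a bare `Classical.choose` minimiser whose measurability is the (H-U) species' TWIN (the D1 (B) repair concerns def-R's (2.12) box map `UminOfRecord`, a
  different object); so at the C4 species the `Integrable`∕`IsRT` β-input faces are CONDITIONAL on `hU` (a face hypothesis, not a record field), while `=ᵐ` and the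
  determinacy on `regSet` stay unconditional.  With def-χ's `chiFixed7` (measurable by theorem) everything in §2 is unconditional (`…_chiFixed7` corollaries).

HONEST FRAMING: kernel bookkeeping (`Integrable.mono'`, measurability algebra); nothing of Bałaban's asserted; no estimate; NOT a discharge claim; counts unmoved (typed
28∕28 · discharged 5∕28); one finite four-torus programme at fixed `ε = L^{−K}` — NOT continuum ∕ ℝ⁴ ∕ OS ∕ mass gap ∕ Clay.  No `sorry`, no `axiom`, no `instance`,
no `notation`.
-/

noncomputable section

open MeasureTheory Set

namespace Literature.MathematicalPhysics.QuantumFieldTheory.Balaban1983to89.Node00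

open T4Continuum (T4Family)
open B12Eq019ActionBody (integrand integrand_apply nextAction_apply normConst)
open B12NodeKnitContinuousTransport (measurable_gfOfRecord gfOfRecord_nonneg chiFixed7_le_one integrable_of_bounded_measurable abs_integrand_le
  measurable_integrand)

variable {F : T4Family} {N : ℕ} [NeZero N]

/-! ## §1. The domination induction, χ- and transport-generic -/

omit [NeZero N] in
/-- `exp (log x) ≤ |x| + 1` (plumbing; FILE 2 keeps its copy private). [folklore] -/
private theorem exp_log_le_abs_add_one' (x : ℝ) : Real.exp (Real.log x) ≤ |x| + 1 := by
  by_cases hx : x = 0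
  · rw [hx, Real.log_zero, Real.exp_zero]; simp
  · rw [Real.exp_log_eq_abs hx]; linarith [abs_nonneg x]

/-- **EVERY β-INPUT OF THE (0.19) RECURSION IS INTEGRABLE**, `k ≤ K`, for ANY transport `T` sending integrable densities to integrable images at the steps `k < K` (the
versions of the kernel transform of record: `TcOnOfRecord ν`, `TcanOfRecord`) and ANY χ family that is MEASURABLE with values in `[0,1]`: level 0 is transport-free
(`A_0 = −A/g_0² ≤ 0`, `|ρ_0| ≤ 1`), and `|ρ_{k+1}| ≤ exp A_{k+1} = exp log(𝐍_k⁻¹·T_kρ_k) ≤ |𝐍_k⁻¹·T_kρ_k| + 1` is an integrable dominant.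
[cite: Balaban1987RG1, (0.17)–(0.19) p.255] -/
theorem integrable_betaInputOfRecord_of_version (T : Transport F N) (K : ℕ)
    (hT : ∀ k, k < K → ∀ ρ : Density (F.P K) k (SU N), Integrable ρ (fieldMeasure (F.P K) k (SU N)) →
      Integrable (T K k ρ) (fieldMeasure (F.P K) (k + 1) (SU N)))
    (χ : (K : ℕ) → (ℕ → ℝ) → (k : ℕ) → Density (F.P K) k (SU N)) (g : ℕ → ℝ) (hχm : ∀ k, Measurable (χ K g k))
    (hχ0 : ∀ k U, 0 ≤ χ K g k U) (hχ1 : ∀ k U, χ K g k U ≤ 1) :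
    ∀ {k : ℕ}, k ≤ K → Integrable (betaInputOfRecord F N T χ K g k) (fieldMeasure (F.P K) k (SU N))
  | 0, _ => by
    -- level 0 reads no transport: `A_0 = −(1/g_0²)A ≤ 0`, so `|ρ_0| ≤ 1`
    show Integrable (integrand (χ K g 0) (gfOfRecord F N K 0) (g 0) (effActionHT F N T χ K g 0)) _
    rw [effActionHT_zero]
    refine integrable_of_bounded_measurable
      (measurable_integrand (hχm 0) (measurable_gfOfRecord K 0) (T4WilsonResponseJunction.measurable_neg_mul_wilsonAction _ _) (g 0))
      (abs_integrand_le (hχ0 0) (hχ1 0) (gfOfRecord_nonneg K 0) (g 0) (B := 1) fun U => ?_)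
    rw [B12Eq019ActionBody.wilsonTerm_apply]
    refine Real.exp_le_one_iff.2 ?_
    have hA : 0 ≤ wilsonAction 1 U := wilsonAction4_nonneg U
    have : 0 ≤ 1 / g 0 ^ 2 * wilsonAction 1 U := mul_nonneg (one_div_nonneg.2 (sq_nonneg _)) hA
    linarith
  | k + 1, hk => by
    have hk' : k < K := Nat.lt_of_succ_le hk
    have hρ := integrable_betaInputOfRecord_of_version T K hT χ g hχm hχ0 hχ1 hk'.le
    have hTρ : Integrable (T K k (betaInputOfRecord F N T χ K g k)) (fieldMeasure (F.P K) (k + 1) (SU N)) := hT k hk' _ hρ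
    set c : ℝ := (normConst (T K k) (χ K g k) (gfOfRecord F N K k) (g k) (effActionHT F N T χ K g k))⁻¹ with hc
    -- `A_{k+1} = log (c · T_kρ_k)` is a.e.-measurable
    have hA : AEMeasurable (effActionHT F N T χ K g (k + 1)) (fieldMeasure (F.P K) (k + 1) (SU N)) := by
      rw [effActionHT_succ]
      exact Real.measurable_log.comp_aemeasurable (hTρ.1.aemeasurable.const_mul c)
    have hmeas : AEStronglyMeasurable (betaInputOfRecord F N T χ K g (k + 1)) (fieldMeasure (F.P K) (k + 1) (SU N)) := by
      show AEStronglyMeasurable (integrand (χ K g (k + 1)) (gfOfRecord F N K (k + 1)) (g (k + 1)) (effActionHT F N T χ K g (k + 1))) _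
      rw [B12Eq019ActionBody.integrand_eq]
      exact ((hχm (k + 1)).aemeasurable.mul
        (Real.measurable_exp.comp_aemeasurable
          (((measurable_const.mul (measurable_gfOfRecord K (k + 1))).aemeasurable).add hA))).aestronglyMeasurable
    -- domination by `|c · T_kρ_k| + 1`
    refine Integrable.mono' ((hTρ.const_mul c).abs.add (integrable_const 1)) hmeas (Filter.Eventually.of_forall fun U => ?_)
    rw [Real.norm_eq_abs]
    show |integrand (χ K g (k + 1)) (gfOfRecord F N K (k + 1)) (g (k + 1)) (effActionHT F N T χ K g (k + 1)) U| ≤ _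
    refine (abs_integrand_le_exp (hχ0 (k + 1)) (hχ1 (k + 1)) (gfOfRecord_nonneg K (k + 1)) (g (k + 1)) U).trans ?_
    rw [effActionHT_succ, nextAction_apply]
    exact exp_log_le_abs_add_one' _

/-! ## §2. At the canonical-version transport `TcanOfRecord` and at the on-domain transport `TcOnOfRecord ν` (χ-generic) -/

/-- **Every β-input over `TcanOfRecord` is integrable**, `k ≤ K`, χ measurable `[0,1]`-valued. [cite: Balaban1987RG1, (0.19) p.255] -/
theorem integrable_betaInput_TcanOfRecord (χ : (K : ℕ) → (ℕ → ℝ) → (k : ℕ) → Density (F.P K) k (SU N)) (K : ℕ) (g : ℕ → ℝ)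
    (hχm : ∀ k, Measurable (χ K g k)) (hχ0 : ∀ k U, 0 ≤ χ K g k U) (hχ1 : ∀ k U, χ K g k U ≤ 1) {k : ℕ} (hk : k ≤ K) :
    Integrable (betaInputOfRecord F N (TcanOfRecord F N) χ K g k) (fieldMeasure (F.P K) k (SU N)) :=
  integrable_betaInputOfRecord_of_version (TcanOfRecord F N) K (fun _ hj _ hρ => integrable_TcanOfRecord hj hρ) χ g hχm hχ0 hχ1 hk

/-- **UNCONDITIONAL `IsRT` AT EVERY β-INPUT OVER `TcanOfRecord`**: `k < K`, χ measurable `[0,1]`-valued — the image IS a renormalisation transformation of the β-input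
(push-forward identity), with no continuity proviso anywhere. [cite: Balaban1985Averaging, (10) p.19; Balaban1987RG1, (0.19) p.255] -/
theorem isRT_TcanOfRecord_betaInput (χ : (K : ℕ) → (ℕ → ℝ) → (k : ℕ) → Density (F.P K) k (SU N)) (K : ℕ) (g : ℕ → ℝ)
    (hχm : ∀ k, Measurable (χ K g k)) (hχ0 : ∀ k U, 0 ≤ χ K g k U) (hχ1 : ∀ k U, χ K g k U ≤ 1) {k : ℕ} (hk : k < K) :
    IsRT (avOfRecord F N K k).avg (betaInputOfRecord F N (TcanOfRecord F N) χ K g k)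
      (TcanOfRecord F N K k (betaInputOfRecord F N (TcanOfRecord F N) χ K g k)) :=
  isRT_TcanOfRecord hk (integrable_betaInput_TcanOfRecord χ K g hχm hχ0 hχ1 hk.le)

/-- The image of every β-input over `TcanOfRecord` is a VERSION of its kernel transform of record (no hypothesis on χ at all). [cite: Balaban1988Convergent, (3.1) p.264 (bookkeeping)] -/
theorem betaInput_TcanOfRecord_ae_eq (χ : (K : ℕ) → (ℕ → ℝ) → (k : ℕ) → Density (F.P K) k (SU N)) (K : ℕ) (g : ℕ → ℝ) (k : ℕ) :
    (fun V : PBond (F.P K) (k + 1) → SU N => TcanOfRecord F N K k (betaInputOfRecord F N (TcanOfRecord F N) χ K g k) V)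
      =ᵐ[piHaar (F.P K) (k + 1) (SU N)] fun V => transportOfRecord F N K k (betaInputOfRecord F N (TcanOfRecord F N) χ K g k) V :=
  TcanOfRecord_ae_eq K k _

/-- Every β-input over the on-domain transport `TcOnOfRecord ν` is integrable, `k ≤ K`, for ANY measurable `[0,1]`-valued χ (FILE 2's lemma is the `chiFixed7 ν` case).
[cite: Balaban1987RG1, (0.19) p.255] -/
theorem integrable_betaInput_TcOnOfRecord (ν : Stage7Numerics) (χ : (K : ℕ) → (ℕ → ℝ) → (k : ℕ) → Density (F.P K) k (SU N)) (K : ℕ) (g : ℕ → ℝ)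
    (hχm : ∀ k, Measurable (χ K g k)) (hχ0 : ∀ k U, 0 ≤ χ K g k U) (hχ1 : ∀ k U, χ K g k U ≤ 1) {k : ℕ} (hk : k ≤ K) :
    Integrable (betaInputOfRecord F N (TcOnOfRecord F N ν) χ K g k) (fieldMeasure (F.P K) k (SU N)) :=
  integrable_betaInputOfRecord_of_version (TcOnOfRecord F N ν) K (fun _ hj _ hρ => integrable_TcOnOfRecord ν hj hρ) χ g hχm hχ0 hχ1 hk

/-- Unconditional `IsRT` at every β-input over `TcOnOfRecord ν`, `k < K`, ANY measurable `[0,1]`-valued χ. [cite: Balaban1985Averaging, (10) p.19; Balaban1987RG1, (0.19) p.255] -/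
theorem isRT_TcOnOfRecord_betaInput (ν : Stage7Numerics) (χ : (K : ℕ) → (ℕ → ℝ) → (k : ℕ) → Density (F.P K) k (SU N)) (K : ℕ) (g : ℕ → ℝ)
    (hχm : ∀ k, Measurable (χ K g k)) (hχ0 : ∀ k U, 0 ≤ χ K g k U) (hχ1 : ∀ k U, χ K g k U ≤ 1) {k : ℕ} (hk : k < K) :
    IsRT (avOfRecord F N K k).avg (betaInputOfRecord F N (TcOnOfRecord F N ν) χ K g k)
      (TcOnOfRecord F N ν K k (betaInputOfRecord F N (TcOnOfRecord F N ν) χ K g k)) :=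
  isRT_TcOnOfRecord ν hk (integrable_betaInput_TcOnOfRecord ν χ K g hχm hχ0 hχ1 hk.le)

/-- At def-χ's `chiFixed7 ν` (measurable by theorem) over `TcanOfRecord`: integrability of every β-input, unconditionally. [cite: Balaban1987RG1, (0.19) p.255] -/
theorem integrable_betaInput_TcanOfRecord_chiFixed7 (ν : Stage7Numerics) (K : ℕ) (g : ℕ → ℝ) {k : ℕ} (hk : k ≤ K) :
    Integrable (betaInputOfRecord F N (TcanOfRecord F N) (chiFixed7 F N ν) K g k) (fieldMeasure (F.P K) k (SU N)) :=
  integrable_betaInput_TcanOfRecord (chiFixed7 F N ν) K g (fun k => measurable_chiFixed7 F N ν K g k) (fun k U => chiFixed7_nonneg F N ν K g k U)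
    (fun k U => chiFixed7_le_one ν K g k U) hk

/-- … and the unconditional `IsRT`, `k < K`. [cite: Balaban1985Averaging, (10) p.19; Balaban1987RG1, (0.19) p.255] -/
theorem isRT_TcanOfRecord_betaInput_chiFixed7 (ν : Stage7Numerics) (K : ℕ) (g : ℕ → ℝ) {k : ℕ} (hk : k < K) :
    IsRT (avOfRecord F N K k).avg (betaInputOfRecord F N (TcanOfRecord F N) (chiFixed7 F N ν) K g k)
      (TcanOfRecord F N K k (betaInputOfRecord F N (TcanOfRecord F N) (chiFixed7 F N ν) K g k)) :=
  isRT_TcanOfRecord_betaInput (chiFixed7 F N ν) K g (fun k => measurable_chiFixed7 F N ν K g k) (fun k U => chiFixed7_nonneg F N ν K g k U)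
    (fun k U => chiFixed7_le_one ν K g k U) hk

/-! ## §3. At the C4 species `chiFixed29 ν ε₁` (Record13's β-slot χ): the same, under the ONE displayed measurability hypothesis on node00-def-B's background -/

/-- The (2.9)-keyed β-slot χ takes values in `[0,1]`. [cite: Balaban1987RG1, (2.9) p.266 (bookkeeping)] -/
theorem chiFixed29_nonneg (ν : Stage7Numerics) (ε₁ : ℝ) (K : ℕ) (g : ℕ → ℝ) (k : ℕ) (V : GaugeField (F.P K) k (SU N)) :
    0 ≤ chiFixed29 F N ν ε₁ K g k V :=
  (chiFix29OfRecord_mem_Icc ν ε₁ K k V).1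

/-- … and `≤ 1`. [cite: Balaban1987RG1, (2.9) p.266 (bookkeeping)] -/
theorem chiFixed29_le_one (ν : Stage7Numerics) (ε₁ : ℝ) (K : ℕ) (g : ℕ → ℝ) (k : ℕ) (V : GaugeField (F.P K) k (SU N)) :
    chiFixed29 F N ν ε₁ K g k V ≤ 1 :=
  (chiFix29OfRecord_mem_Icc ν ε₁ K k V).2

/-- The (2.9)-keyed β-slot χ is measurable at every run and step AS SOON AS node00-def-B's background maps `W ↦ U_{k+1}(W)` are (the (H-U) twin; DISPLAYED).
[cite: Balaban1987RG1, (2.9) p.266 (bookkeeping)] -/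
theorem measurable_chiFixed29_of {ν : Stage7Numerics} (ε₁ : ℝ) {K : ℕ} (hU : ∀ k, Measurable (Uk F N K (k + 1) ν.εreg)) (g : ℕ → ℝ) (k : ℕ) :
    Measurable (chiFixed29 F N ν ε₁ K g k) :=
  measurable_chiFix29OfRecord_of ε₁ (hU k)

/-- **AT THE C4 SPECIES over `TcanOfRecord`: every β-input is integrable**, `k ≤ K`, under the displayed measurability of def-B's backgrounds on this torus.
[cite: Balaban1987RG1, (0.19) p.255 and (2.9) p.266] -/
theorem integrable_betaInput_TcanOfRecord_chi29 (ν : Stage7Numerics) (ε₁ : ℝ) (K : ℕ) (hU : ∀ k, Measurable (Uk F N K (k + 1) ν.εreg)) (g : ℕ → ℝ)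
    {k : ℕ} (hk : k ≤ K) : Integrable (betaInputOfRecord F N (TcanOfRecord F N) (chiFixed29 F N ν ε₁) K g k) (fieldMeasure (F.P K) k (SU N)) :=
  integrable_betaInput_TcanOfRecord (chiFixed29 F N ν ε₁) K g (fun k => measurable_chiFixed29_of ε₁ hU g k)
    (fun k U => chiFixed29_nonneg ν ε₁ K g k U) (fun k U => chiFixed29_le_one ν ε₁ K g k U) hk

/-- **AT THE C4 SPECIES over `TcanOfRecord`: the UNCONDITIONAL-IN-CONTINUITY `IsRT` at every β-input**, `k < K`, under the displayed measurability of def-B's backgrounds —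
the `IsRT` face Record13 §8 reads. [cite: Balaban1985Averaging, (10) p.19; Balaban1987RG1, (0.19) p.255 and (2.9) p.266] -/
theorem isRT_TcanOfRecord_betaInput_chi29 (ν : Stage7Numerics) (ε₁ : ℝ) (K : ℕ) (hU : ∀ k, Measurable (Uk F N K (k + 1) ν.εreg)) (g : ℕ → ℝ)
    {k : ℕ} (hk : k < K) :
    IsRT (avOfRecord F N K k).avg (betaInputOfRecord F N (TcanOfRecord F N) (chiFixed29 F N ν ε₁) K g k)
      (TcanOfRecord F N K k (betaInputOfRecord F N (TcanOfRecord F N) (chiFixed29 F N ν ε₁) K g k)) :=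
  isRT_TcanOfRecord_betaInput (chiFixed29 F N ν ε₁) K g (fun k => measurable_chiFixed29_of ε₁ hU g k)
    (fun k U => chiFixed29_nonneg ν ε₁ K g k U) (fun k U => chiFixed29_le_one ν ε₁ K g k U) hk

/-- … and the image is a version of the kernel transform (no hypothesis). [cite: Balaban1988Convergent, (3.1) p.264 (bookkeeping)] -/
theorem betaInput_TcanOfRecord_chi29_ae_eq (ν : Stage7Numerics) (ε₁ : ℝ) (K : ℕ) (g : ℕ → ℝ) (k : ℕ) :
    (fun V : PBond (F.P K) (k + 1) → SU N => TcanOfRecord F N K k (betaInputOfRecord F N (TcanOfRecord F N) (chiFixed29 F N ν ε₁) K g k) V)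
      =ᵐ[piHaar (F.P K) (k + 1) (SU N)] fun V => transportOfRecord F N K k (betaInputOfRecord F N (TcanOfRecord F N) (chiFixed29 F N ν ε₁) K g k) V :=
  betaInput_TcanOfRecord_ae_eq _ K g k

end Literature.MathematicalPhysics.QuantumFieldTheory.Balaban1983to89.Node00

end
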